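import Literature.MathematicalPhysics.KineticTheory.HardSphereEulerProofs

/-!
# Exponential concentration of the velocity fluctuations of a local Gibbs state

Helper file for the support item `UniformLocalGibbsConcentration` (routes `OneFlightGossipEngine`, `TwoClocks`)
(stmt-AtomisticToContinuum-14445): the Chernoff version of `localGibbsMeasure_velFluct_le` of
`HardSphereEulerProofs` (which is Bienaymé–Chebyshev). Conditionally on the positions, the
velocities of a local Gibbs state are independent Gaussians `N(u₀(xᵢ), θ₀(xᵢ) id)`; for a
per-particle observable `Y(x, v)` which is centred under `N(u₀(x), θ₀(x) id)` and has a UNIFORM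
exponential moment `∫ e^{s₀ |Y(x, ·)|} ≤ A`, and a continuous `|χ| ≤ C`, the local Gibbs probability
of `{δ ≤ |(N+1)⁻¹ ∑ᵢ χ(xᵢ) Y(xᵢ, vᵢ)|}` is at most `2 e^{-r (N+1)}` with an explicit
`r = r(s₀, A, C, δ) > 0` (`localGibbsMeasure_velFluct_exp_le`).

* `exp_sub_one_sub_le` — `e^{sy} - 1 - sy ≤ 32 (s/s₀)² e^{s₀|y|}` for `|s| ≤ s₀/2`;
* `integral_exp_mul_le` — the single-factor bound `E e^{sY} ≤ exp(32 A s²/s₀²)` for centred `Y`;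
* `pi_measure_sum_ge_le` — Chernoff's bound for a sum of independent variables on a finite
  product of probability spaces;
* `exists_expMoment_of_quadratic_bound` — the uniform exponential moment for Gaussian
  functionals with `|Y(x, u₀(x) + √θ₀(x) w)| ≤ K (1 + |w|²)` (Fernique's theorem for the standard
  Gaussian on `ℝ³`), which covers the momentum (`v ↦ vₗ - u₀ₗ`) and kinetic-energy
  (`v ↦ |v|²/2 - |u₀|²/2 - 3θ₀/2`) fluctuations.
-/

noncomputable section

namespace Summit.AtomisticToContinuum.HydrodynamicLimit.Theorems

namespace UniformLGC

open MeasureTheory ProbabilityTheory Filter Set Topology Finset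
open scoped ENNReal
open Literature.MathematicalPhysics.KineticTheory

/-! ### The single-factor moment generating function -/

/-- `y² ≤ (16/s₀²) e^{s₀|y|/2}` (from `e^v ≥ (1 + v/2)² ≥ v²/4`). -/
theorem sq_le_mul_exp {s₀ : ℝ} (hs₀ : 0 < s₀) (y : ℝ) :
    y ^ 2 ≤ 16 / s₀ ^ 2 * Real.exp (s₀ * |y| / 2) := by
  set v := s₀ * |y| / 2 with hv
  have hv0 : 0 ≤ v := by positivity
  have h1 : 1 + v / 2 ≤ Real.exp (v / 2) := by linarith [Real.add_one_le_exp (v / 2)]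
  have h2 : (1 + v / 2) ^ 2 ≤ Real.exp (v / 2) ^ 2 := pow_le_pow_left₀ (by positivity) h1 2
  have h3 : Real.exp (v / 2) ^ 2 = Real.exp v := by rw [sq, ← Real.exp_add]; ring_nf
  have h4 : v ^ 2 / 4 ≤ Real.exp v := by nlinarith
  have h5 : v ^ 2 = s₀ ^ 2 * y ^ 2 / 4 := by rw [hv, div_pow, mul_pow, sq_abs]; ring
  rw [h5] at h4
  rw [div_mul_eq_mul_div, le_div_iff₀ (by positivity)]
  nlinarith

/-- **The second-order exponential inequality**: `e^{sy} - 1 - sy ≤ 32 (s/s₀)² e^{s₀|y|}` for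
`|s| ≤ s₀/2` (Taylor for `|sy| ≤ 1`, the crude bound `2 e^{|sy|} (sy)²` otherwise). -/
theorem exp_sub_one_sub_le {s₀ s : ℝ} (hs₀ : 0 < s₀) (hs : |s| ≤ s₀ / 2) (y : ℝ) :
    Real.exp (s * y) - 1 - s * y ≤ 32 * s ^ 2 / s₀ ^ 2 * Real.exp (s₀ * |y|) := by
  set u := s * y with hu
  have hy2 := sq_le_mul_exp hs₀ y
  have hsy : |s| * |y| ≤ s₀ * |y| / 2 := by
    have := mul_le_mul_of_nonneg_right hs (abs_nonneg y); linarith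
  have hy0 : 0 ≤ s₀ * |y| := by positivity
  have hhalf : Real.exp (s₀ * |y| / 2) ≤ Real.exp (s₀ * |y|) := Real.exp_le_exp.2 (by linarith)
  have hu2 : u ^ 2 ≤ 16 * s ^ 2 / s₀ ^ 2 * Real.exp (s₀ * |y| / 2) := by
    rw [hu, mul_pow]
    calc s ^ 2 * y ^ 2 ≤ s ^ 2 * (16 / s₀ ^ 2 * Real.exp (s₀ * |y| / 2)) :=
          mul_le_mul_of_nonneg_left hy2 (sq_nonneg s)
      _ = _ := by ring
  have hexp0 : 0 < Real.exp (s₀ * |y| / 2) := Real.exp_pos _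
  by_cases h1 : |u| ≤ 1
  · -- Taylor: `|e^u - 1 - u| ≤ (3/4) u²`
    have hT := Real.exp_bound h1 (n := 2) (by norm_num)
    have hsum : ∑ m ∈ range 2, u ^ m / (m.factorial : ℝ) = 1 + u := by
      simp [Finset.sum_range_succ]
    rw [hsum] at hT
    have hT' : Real.exp u - 1 - u ≤ u ^ 2 := by
      have := (le_abs_self _).trans hT
      have hu2' : |u| ^ 2 = u ^ 2 := sq_abs u
      norm_num at this
      nlinarith [sq_nonneg u, abs_nonneg u]
    calc Real.exp u - 1 - u ≤ u ^ 2 := hT'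
      _ ≤ 16 * s ^ 2 / s₀ ^ 2 * Real.exp (s₀ * |y| / 2) := hu2
      _ ≤ 32 * s ^ 2 / s₀ ^ 2 * Real.exp (s₀ * |y|) := by
          refine mul_le_mul ?_ hhalf hexp0.le (by positivity)
          refine div_le_div_of_nonneg_right ?_ (by positivity)
          nlinarith [sq_nonneg s]
  · -- crude: `e^u - 1 - u ≤ 2 e^{|u|} ≤ 2 u² e^{|u|}`
    push Not at h1
    have hexpu : Real.exp u ≤ Real.exp |u| := Real.exp_le_exp.2 (le_abs_self u)
    have habs_exp : |u| ≤ Real.exp |u| := by linarith [Real.add_one_le_exp |u|]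
    have hu1 : 1 ≤ u ^ 2 := by nlinarith [sq_abs u]
    have hexp_abs : Real.exp |u| ≤ Real.exp (s₀ * |y| / 2) := by
      rw [hu, abs_mul]; exact Real.exp_le_exp.2 hsy
    have hE0 : 0 < Real.exp |u| := Real.exp_pos _
    calc Real.exp u - 1 - u ≤ 2 * Real.exp |u| := by linarith [neg_abs_le u]
      _ ≤ 2 * (u ^ 2 * Real.exp |u|) := by nlinarith
      _ ≤ 2 * ((16 * s ^ 2 / s₀ ^ 2 * Real.exp (s₀ * |y| / 2)) * Real.exp (s₀ * |y| / 2)) := by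
          gcongr
      _ = 32 * s ^ 2 / s₀ ^ 2 * Real.exp (s₀ * |y|) := by
          rw [mul_assoc (16 * s ^ 2 / s₀ ^ 2), ← Real.exp_add]; ring_nf

/-- **Single-factor bound**: for a probability measure `γ` and a centred `Y` with
`∫ e^{s₀|Y|} dγ ≤ A`, `∫ e^{sY} dγ ≤ exp(32 A s²/s₀²)` for `|s| ≤ s₀/2` (with integrability). -/
theorem integral_exp_mul_le {V : Type*} [MeasurableSpace V] (γ : Measure V) [IsProbabilityMeasure γ]
    {Y : V → ℝ} (hY : Measurable Y) (hY0 : ∫ v, Y v ∂γ = 0) {s₀ A : ℝ} (hs₀ : 0 < s₀)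
    (hint : Integrable (fun v => Real.exp (s₀ * |Y v|)) γ) (hA : ∫ v, Real.exp (s₀ * |Y v|) ∂γ ≤ A)
    {s : ℝ} (hs : |s| ≤ s₀ / 2) :
    Integrable (fun v => Real.exp (s * Y v)) γ ∧
      ∫ v, Real.exp (s * Y v) ∂γ ≤ Real.exp (32 * A * s ^ 2 / s₀ ^ 2) := by
  -- domination of `e^{sY}` and of `Y` by `e^{s₀|Y|}`
  have hdom : ∀ v, Real.exp (s * Y v) ≤ Real.exp (s₀ * |Y v|) := by
    intro v
    refine Real.exp_le_exp.2 ((le_abs_self _).trans ?_)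
    rw [abs_mul]
    have := mul_le_mul_of_nonneg_right hs (abs_nonneg (Y v))
    nlinarith [abs_nonneg (Y v), abs_nonneg s]
  have hexp_int : Integrable (fun v => Real.exp (s * Y v)) γ :=
    hint.mono' (measurable_const.mul hY).exp.aestronglyMeasurable
      (ae_of_all _ fun v => by rw [Real.norm_eq_abs, abs_of_pos (Real.exp_pos _)]; exact hdom v)
  have hY_int : Integrable Y γ := by
    refine (hint.const_mul s₀⁻¹).mono' hY.aestronglyMeasurable (ae_of_all _ fun v => ?_)
    rw [Real.norm_eq_abs]
    have h1 : s₀ * |Y v| ≤ Real.exp (s₀ * |Y v|) := by linarith [Real.add_one_le_exp (s₀ * |Y v|)]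
    rw [le_inv_mul_iff₀' hs₀]
    linarith
  refine ⟨hexp_int, ?_⟩
  have hpt : ∀ v, Real.exp (s * Y v) ≤ 1 + s * Y v + 32 * s ^ 2 / s₀ ^ 2 * Real.exp (s₀ * |Y v|) := by
    intro v; have := exp_sub_one_sub_le hs₀ hs (Y v); linarith
  have hrhs : Integrable (fun v => 1 + s * Y v + 32 * s ^ 2 / s₀ ^ 2 * Real.exp (s₀ * |Y v|)) γ :=
    ((integrable_const _).add (hY_int.const_mul s)).add (hint.const_mul _)
  calc ∫ v, Real.exp (s * Y v) ∂γ ≤ ∫ v, (1 + s * Y v + 32 * s ^ 2 / s₀ ^ 2 * Real.exp (s₀ * |Y v|)) ∂γ :=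
        integral_mono hexp_int hrhs hpt
    _ = 1 + 32 * s ^ 2 / s₀ ^ 2 * ∫ v, Real.exp (s₀ * |Y v|) ∂γ := by
        have hi1 : Integrable (fun v => (1 : ℝ) + s * Y v) γ := (integrable_const _).add (hY_int.const_mul s)
        have hi2 : Integrable (fun v => 32 * s ^ 2 / s₀ ^ 2 * Real.exp (s₀ * |Y v|)) γ := hint.const_mul _
        rw [integral_add hi1 hi2, integral_add (integrable_const _) (hY_int.const_mul s), integral_const_mul,
          integral_const_mul, hY0, integral_const]
        simp
    _ ≤ 1 + 32 * s ^ 2 / s₀ ^ 2 * A := by gcongr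
    _ = 1 + 32 * A * s ^ 2 / s₀ ^ 2 := by ring
    _ ≤ Real.exp (32 * A * s ^ 2 / s₀ ^ 2) := by linarith [Real.add_one_le_exp (32 * A * s ^ 2 / s₀ ^ 2)]

/-! ### Chernoff's bound on a finite product of probability spaces -/

/-- **Chernoff's bound**: for independent coordinates `vᵢ ∼ μᵢ`, measurable `Zᵢ` with
`E e^{s Zᵢ(vᵢ)} ≤ e^{K}` (`s ≥ 0`), `ℙ(a ≤ ∑ Zᵢ(vᵢ)) ≤ exp(-s a + #ι · K)`. -/
theorem pi_measure_sum_ge_le {ι : Type*} [Fintype ι] {V : Type*} [MeasurableSpace V]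
    (μ : ι → Measure V) [∀ i, IsProbabilityMeasure (μ i)] {Z : ι → V → ℝ} (hZm : ∀ i, Measurable (Z i))
    {s K : ℝ} (hs : 0 ≤ s)
    (hmgf : ∀ i, Integrable (fun v => Real.exp (s * Z i v)) (μ i) ∧ ∫ v, Real.exp (s * Z i v) ∂μ i ≤ Real.exp K)
    (a : ℝ) :
    Measure.pi μ {v | a ≤ ∑ i, Z i (v i)} ≤ ENNReal.ofReal (Real.exp (-(s * a) + Fintype.card ι * K)) := by
  set f : (ι → V) → ℝ≥0∞ := fun v => ENNReal.ofReal (Real.exp (s * ∑ i, Z i (v i))) with hf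
  have hSm : Measurable fun v : ι → V => ∑ i, Z i (v i) :=
    Finset.measurable_sum _ fun i _ => (hZm i).comp (measurable_pi_apply i)
  have hfm : Measurable f := (measurable_const.mul hSm).exp.ennreal_ofReal
  have hsub : {v : ι → V | a ≤ ∑ i, Z i (v i)} ⊆ {v | ENNReal.ofReal (Real.exp (s * a)) ≤ f v} := by
    intro v hv
    simp only [Set.mem_setOf_eq] at hv ⊢
    exact ENNReal.ofReal_le_ofReal (Real.exp_le_exp.2 (mul_le_mul_of_nonneg_left hv hs))
  refine (measure_mono hsub).trans ?_
  have hmarkov := meas_ge_le_lintegral_div hfm.aemeasurable (ε := ENNReal.ofReal (Real.exp (s * a)))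
    (ENNReal.ofReal_pos.2 (Real.exp_pos _)).ne' ENNReal.ofReal_ne_top (μ := Measure.pi μ)
  refine hmarkov.trans ?_
  -- the integral factorises
  have hprod : ∫⁻ v, f v ∂Measure.pi μ = ∏ i, ∫⁻ w, ENNReal.ofReal (Real.exp (s * Z i w)) ∂μ i := by
    have h := lintegral_fintype_prod_eq_prod' μ (f := fun i w => ENNReal.ofReal (Real.exp (s * Z i w)))
      (fun i => (measurable_const.mul (hZm i)).exp.ennreal_ofReal)
    rw [← h]
    refine lintegral_congr fun v => ?_
    rw [hf]; dsimp only
    rw [mul_sum, Real.exp_sum, ENNReal.ofReal_prod_of_nonneg fun i _ => (Real.exp_pos _).le]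
  have hfac : ∀ i, ∫⁻ w, ENNReal.ofReal (Real.exp (s * Z i w)) ∂μ i ≤ ENNReal.ofReal (Real.exp K) := by
    intro i
    rw [← ofReal_integral_eq_lintegral_ofReal (hmgf i).1 (ae_of_all _ fun w => (Real.exp_pos _).le)]
    exact ENNReal.ofReal_le_ofReal (hmgf i).2
  have hprod_le : ∫⁻ v, f v ∂Measure.pi μ ≤ ENNReal.ofReal (Real.exp (Fintype.card ι * K)) := by
    rw [hprod]
    calc ∏ i, ∫⁻ w, ENNReal.ofReal (Real.exp (s * Z i w)) ∂μ i ≤ ∏ _i : ι, ENNReal.ofReal (Real.exp K) :=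
          prod_le_prod' fun i _ => hfac i
      _ = ENNReal.ofReal (Real.exp (Fintype.card ι * K)) := by
          rw [prod_const, card_univ, ← ENNReal.ofReal_pow (Real.exp_pos _).le, ← Real.exp_nat_mul]
  calc (∫⁻ v, f v ∂Measure.pi μ) / ENNReal.ofReal (Real.exp (s * a))
      ≤ ENNReal.ofReal (Real.exp (Fintype.card ι * K)) / ENNReal.ofReal (Real.exp (s * a)) := by
        gcongr
    _ = ENNReal.ofReal (Real.exp (-(s * a) + Fintype.card ι * K)) := by
        rw [ENNReal.div_eq_inv_mul, ← ENNReal.ofReal_inv_of_pos (Real.exp_pos _), ← Real.exp_neg,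
          ← ENNReal.ofReal_mul (Real.exp_pos _).le, ← Real.exp_add]

/-! ### Uniform exponential moments of Gaussian functionals (Fernique) -/

section ExpMoment

variable {θ₀ : T3 → ℝ} {u₀ : T3 → V3}

/-- **Uniform exponential moments for Gaussian functionals of quadratic growth.** If
`|Y(x, u₀(x) + √θ₀(x) w)| ≤ K (1 + |w|²)` for all `x, w`, then for `s₀ = c/K` (`c` a Fernique
constant of the standard Gaussian on `ℝ³`) the exponential moments `∫ e^{s₀ |Y(x,·)|} dN(u₀(x), θ₀(x))`
are finite and bounded uniformly in `x`. -/
theorem exists_expMoment_of_quadratic_bound {Y : T3 → V3 → ℝ}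
    (hYm : Measurable fun p : T3 × V3 => Y p.1 p.2) {K : ℝ} (hK : 0 < K)
    (hYK : ∀ x w, |Y x (u₀ x + Real.sqrt (θ₀ x) • w)| ≤ K * (1 + ‖w‖ ^ 2)) :
    ∃ s₀ A : ℝ, 0 < s₀ ∧ 0 < A ∧ ∀ x,
      Integrable (fun v => Real.exp (s₀ * |Y x v|)) (gaussMeasure (u₀ x) (θ₀ x)) ∧
        ∫ v, Real.exp (s₀ * |Y x v|) ∂gaussMeasure (u₀ x) (θ₀ x) ≤ A := by
  obtain ⟨c, hc, hFer⟩ := ProbabilityTheory.IsGaussian.exists_integrable_exp_sq (stdGaussian V3)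
  have hdom_int : Integrable (fun w : V3 => Real.exp (c + c * ‖w‖ ^ 2)) (stdGaussian V3) := by
    simp_rw [Real.exp_add]
    exact hFer.const_mul _
  refine ⟨c / K, ∫ w, Real.exp (c + c * ‖w‖ ^ 2) ∂stdGaussian V3, div_pos hc hK,
    integral_exp_pos hdom_int, fun x => ?_⟩
  have hYxm : Measurable (Y x) := hYm.comp (measurable_const.prodMk measurable_id)
  have hgm : Measurable fun v => Real.exp (c / K * |Y x v|) := (measurable_const.mul hYxm.abs).exp
  have hT := measurable_gaussShift (u₀ x) (θ₀ x)
  have hbound : ∀ w : V3, Real.exp (c / K * |Y x (u₀ x + Real.sqrt (θ₀ x) • w)|) ≤ Real.exp (c + c * ‖w‖ ^ 2) := by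
    intro w
    refine Real.exp_le_exp.2 ?_
    have h := mul_le_mul_of_nonneg_left (hYK x w) (div_pos hc hK).le
    have : c / K * (K * (1 + ‖w‖ ^ 2)) = c + c * ‖w‖ ^ 2 := by field_simp
    linarith
  have hcomp : Integrable ((fun v => Real.exp (c / K * |Y x v|)) ∘ fun w => u₀ x + Real.sqrt (θ₀ x) • w)
      (stdGaussian V3) :=
    hdom_int.mono' (hgm.comp hT).aestronglyMeasurable (ae_of_all _ fun w => by
      rw [Function.comp_apply, Real.norm_eq_abs, abs_of_pos (Real.exp_pos _)]; exact hbound w)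
  constructor
  · rw [gaussMeasure]
    exact (integrable_map_measure hgm.aestronglyMeasurable hT.aemeasurable).2 hcomp
  · rw [gaussMeasure, integral_map hT.aemeasurable hgm.aestronglyMeasurable]
    exact integral_mono hcomp hdom_int hbound

end ExpMoment

/-! ### Velocity fluctuations of a local Gibbs state -/

section LocalGibbs

variable {a₀ θ₀ : T3 → ℝ} {u₀ : T3 → V3}

/-- **Exponential concentration of the velocity fluctuations.** For a jointly measurable family
of per-particle velocity observables `Y x : ℝ³ → ℝ` which, under `N(u₀(x), θ₀(x) id)`, are centred
and have a uniform exponential moment `∫ e^{s₀|Y(x,·)|} ≤ A`, and a continuous `χ` with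
`|χ| ≤ C` (`C > 0`): the local Gibbs probability of `{δ ≤ |(N+1)⁻¹ ∑ᵢ χ(xᵢ) Y(xᵢ, vᵢ)|}` is at most
`2 exp(-r (N+1))`, `r = δ/2 · min(s₀/(2C), δ s₀²/(64 A C²))` (conditionally on the positions the
velocities are independent Gaussians; Chernoff). -/
theorem localGibbsMeasure_velFluct_exp_le (ha : Continuous a₀) (hθ : Continuous θ₀)
    (hu : Continuous u₀) (ha0 : ∀ x, 0 ≤ a₀ x) (hθ0 : ∀ x, 0 < θ₀ x) (σ : ℝ) (N : ℕ)
    [IsProbabilityMeasure (localGibbsMeasure σ a₀ u₀ θ₀ N)]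
    {Y : T3 → V3 → ℝ} (hYm : Measurable fun p : T3 × V3 => Y p.1 p.2)
    (hY0 : ∀ x, ∫ v, Y x v ∂gaussMeasure (u₀ x) (θ₀ x) = 0)
    {s₀ A : ℝ} (hs₀ : 0 < s₀) (hA : 0 < A)
    (hYi : ∀ x, Integrable (fun v => Real.exp (s₀ * |Y x v|)) (gaussMeasure (u₀ x) (θ₀ x)))
    (hYA : ∀ x, ∫ v, Real.exp (s₀ * |Y x v|) ∂gaussMeasure (u₀ x) (θ₀ x) ≤ A)
    {χ : T3 → ℝ} (hχ : Continuous χ) {C : ℝ} (hC0 : 0 < C) (hC : ∀ x, |χ x| ≤ C)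
    {δ : ℝ} (hδ : 0 < δ) :
    localGibbsMeasure σ a₀ u₀ θ₀ N
        {z | δ ≤ |((N + 1 : ℕ) : ℝ)⁻¹ * ∑ i, χ (z i).1 * Y (z i).1 (z i).2|} ≤
      ENNReal.ofReal (2 * Real.exp (-(δ / 2 * min (s₀ / (2 * C)) (δ * s₀ ^ 2 / (64 * A * C ^ 2)) * ((N + 1 : ℕ) : ℝ)))) := by
  set K₀ := 32 * A * C ^ 2 / s₀ ^ 2 with hK₀
  have hK₀0 : 0 < K₀ := by positivity
  set s := min (s₀ / (2 * C)) (δ * s₀ ^ 2 / (64 * A * C ^ 2)) with hsdef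
  have hs0 : 0 < s := lt_min (by positivity) (by positivity)
  have hsC : s * C ≤ s₀ / 2 := by
    have : s ≤ s₀ / (2 * C) := min_le_left _ _
    rw [le_div_iff₀ (by positivity)] at this; linarith
  have hsK : K₀ * s ≤ δ / 2 := by
    have h1 : s ≤ δ * s₀ ^ 2 / (64 * A * C ^ 2) := min_le_right _ _
    have h2 : δ * s₀ ^ 2 / (64 * A * C ^ 2) = δ / 2 / K₀ := by rw [hK₀]; field_simp; ring
    rw [h2, le_div_iff₀ hK₀0] at h1; linarith
  set n := N + 1 with hn
  set E := {z : Literature.Analysis.FluidPDE.Config (N + 1) (Fin 3) T3 |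
    δ ≤ |((N + 1 : ℕ) : ℝ)⁻¹ * ∑ i, χ (z i).1 * Y (z i).1 (z i).2|} with hE
  have hFm : Measurable fun z : Literature.Analysis.FluidPDE.Config (N + 1) (Fin 3) T3 =>
      ((N + 1 : ℕ) : ℝ)⁻¹ * ∑ i, χ (z i).1 * Y (z i).1 (z i).2 := by
    refine measurable_const.mul (Finset.measurable_sum _ fun i _ => ?_)
    exact (hχ.measurable.comp (measurable_pi_apply i).fst).mul (hYm.comp (measurable_pi_apply i))
  have hEm : MeasurableSet E := measurableSet_le measurable_const hFm.abs
  -- per-factor mgf bound, uniformly in the position and for both signs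
  have hfactor : ∀ (x : T3) (e : ℝ), |e| = 1 →
      Integrable (fun v => Real.exp (s * (e * (χ x * Y x v)))) (gaussMeasure (u₀ x) (θ₀ x)) ∧
        ∫ v, Real.exp (s * (e * (χ x * Y x v))) ∂gaussMeasure (u₀ x) (θ₀ x) ≤ Real.exp (K₀ * s ^ 2) := by
    intro x e he
    have hYxm : Measurable (Y x) := hYm.comp (measurable_const.prodMk measurable_id)
    have hs' : |s * e * χ x| ≤ s₀ / 2 := by
      rw [abs_mul, abs_mul, he, mul_one, abs_of_pos hs0]
      exact (mul_le_mul_of_nonneg_left (hC x) hs0.le).trans hsC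
    have h := integral_exp_mul_le (gaussMeasure (u₀ x) (θ₀ x)) hYxm (hY0 x) hs₀ (hYi x) (hYA x) hs'
    have heq : (fun v => Real.exp (s * e * χ x * Y x v)) = fun v => Real.exp (s * (e * (χ x * Y x v))) := by
      funext v; ring_nf
    rw [heq] at h
    refine ⟨h.1, h.2.trans (Real.exp_le_exp.2 ?_)⟩
    rw [hK₀]
    have hχ2 : χ x ^ 2 ≤ C ^ 2 := by
      have := hC x; rw [← sq_abs]; exact pow_le_pow_left₀ (abs_nonneg _) this 2
    have he2 : e ^ 2 = 1 := by rw [← sq_abs, he, one_pow]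
    have : (s * e * χ x) ^ 2 = s ^ 2 * χ x ^ 2 := by rw [mul_pow, mul_pow, he2]; ring
    rw [this]
    have h0 : 0 ≤ 32 * A / s₀ ^ 2 * s ^ 2 := by positivity
    calc 32 * A * (s ^ 2 * χ x ^ 2) / s₀ ^ 2 = 32 * A / s₀ ^ 2 * s ^ 2 * χ x ^ 2 := by ring
      _ ≤ 32 * A / s₀ ^ 2 * s ^ 2 * C ^ 2 := mul_le_mul_of_nonneg_left hχ2 h0
      _ = 32 * A * C ^ 2 / s₀ ^ 2 * s ^ 2 := by ring
  -- conditional (velocity) bound, uniformly in the positions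
  have hvel : ∀ x : Fin (N + 1) → T3,
      velMeasure u₀ θ₀ x {v | zipConfig (x, v) ∈ E} ≤
        ENNReal.ofReal (2 * Real.exp (-(δ / 2 * s * ((N + 1 : ℕ) : ℝ)))) := by
    intro x
    have hsplit : {v : Fin (N + 1) → V3 | zipConfig (x, v) ∈ E} ⊆
        {v | ((N + 1 : ℕ) : ℝ) * δ ≤ ∑ i, (1 : ℝ) * (χ (x i) * Y (x i) (v i))} ∪
          {v | ((N + 1 : ℕ) : ℝ) * δ ≤ ∑ i, (-1 : ℝ) * (χ (x i) * Y (x i) (v i))} := by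
      intro v hv
      simp only [hE, Set.mem_setOf_eq, zipConfig_apply] at hv
      simp only [Set.mem_setOf_eq, Set.mem_union, one_mul, neg_one_mul, sum_neg_distrib]
      have hnpos : (0 : ℝ) < ((N + 1 : ℕ) : ℝ) := by positivity
      rcases le_abs.1 hv with h | h
      · left; rw [le_inv_mul_iff₀ hnpos] at h; linarith
      · right
        have h' : δ ≤ ((N + 1 : ℕ) : ℝ)⁻¹ * -∑ i, χ (x i) * Y (x i) (v i) := by linarith
        rw [le_inv_mul_iff₀ hnpos] at h'; linarith
    refine (measure_mono hsplit).trans ((measure_union_le _ _).trans ?_)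
    have htail : ∀ e : ℝ, |e| = 1 →
        velMeasure u₀ θ₀ x {v | ((N + 1 : ℕ) : ℝ) * δ ≤ ∑ i, e * (χ (x i) * Y (x i) (v i))} ≤
          ENNReal.ofReal (Real.exp (-(δ / 2 * s * ((N + 1 : ℕ) : ℝ)))) := by
      intro e he
      have h := pi_measure_sum_ge_le (fun i => gaussMeasure (u₀ (x i)) (θ₀ (x i)))
        (Z := fun i v => e * (χ (x i) * Y (x i) v))
        (fun i => measurable_const.mul (measurable_const.mul (hYm.comp (measurable_const.prodMk measurable_id))))
        hs0.le (K := K₀ * s ^ 2) (fun i => hfactor (x i) e he) (((N + 1 : ℕ) : ℝ) * δ)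
      refine (le_of_eq rfl).trans (h.trans (ENNReal.ofReal_le_ofReal (Real.exp_le_exp.2 ?_)))
      rw [Fintype.card_fin]
      have hn0 : (0 : ℝ) ≤ ((N + 1 : ℕ) : ℝ) := by positivity
      have : ((N + 1 : ℕ) : ℝ) * (K₀ * s ^ 2) ≤ ((N + 1 : ℕ) : ℝ) * (s * (δ / 2)) := by
        refine mul_le_mul_of_nonneg_left ?_ hn0
        nlinarith
      push_cast at this ⊢
      nlinarith
    calc velMeasure u₀ θ₀ x {v | ((N + 1 : ℕ) : ℝ) * δ ≤ ∑ i, (1 : ℝ) * (χ (x i) * Y (x i) (v i))} +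
          velMeasure u₀ θ₀ x {v | ((N + 1 : ℕ) : ℝ) * δ ≤ ∑ i, (-1 : ℝ) * (χ (x i) * Y (x i) (v i))}
        ≤ ENNReal.ofReal (Real.exp (-(δ / 2 * s * ((N + 1 : ℕ) : ℝ)))) +
            ENNReal.ofReal (Real.exp (-(δ / 2 * s * ((N + 1 : ℕ) : ℝ)))) :=
          add_le_add (htail 1 (by simp)) (htail (-1) (by simp))
      _ = ENNReal.ofReal (2 * Real.exp (-(δ / 2 * s * ((N + 1 : ℕ) : ℝ)))) := by
          rw [← ENNReal.ofReal_add (Real.exp_pos _).le (Real.exp_pos _).le, two_mul]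
  -- integrate over the positions
  calc localGibbsMeasure σ a₀ u₀ θ₀ N E
      = ∫⁻ z, E.indicator 1 z ∂localGibbsMeasure σ a₀ u₀ θ₀ N := (lintegral_indicator_one hEm).symm
    _ = ∫⁻ x, ENNReal.ofReal ((Literature.Analysis.FluidPDE.canonicalPartition
          (Literature.Analysis.FluidPDE.Torus.geometry (Fin 3)) (hsDiameter σ N)
          (N + 1) (localGibbsProfile a₀ u₀ θ₀))⁻¹ * posWeight a₀ (hsDiameter σ N) (N + 1) x) *
          velMeasure u₀ θ₀ x {v | zipConfig (x, v) ∈ E} := by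
        rw [lintegral_localGibbsMeasure ha hθ hu ha0 hθ0 σ N (measurable_one.indicator hEm)]
        refine lintegral_congr fun x => ?_
        congr 1
        have hpre : MeasurableSet {v : Fin (N + 1) → V3 | zipConfig (x, v) ∈ E} :=
          hEm.preimage (measurable_zipConfig.comp (measurable_const.prodMk measurable_id))
        rw [← lintegral_indicator_one hpre]
        rfl
    _ ≤ ∫⁻ x, ENNReal.ofReal ((Literature.Analysis.FluidPDE.canonicalPartition
          (Literature.Analysis.FluidPDE.Torus.geometry (Fin 3)) (hsDiameter σ N)
          (N + 1) (localGibbsProfile a₀ u₀ θ₀))⁻¹ * posWeight a₀ (hsDiameter σ N) (N + 1) x) *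
          ENNReal.ofReal (2 * Real.exp (-(δ / 2 * s * ((N + 1 : ℕ) : ℝ)))) :=
        lintegral_mono fun x => mul_le_mul_right (hvel x) _
    _ = ENNReal.ofReal (2 * Real.exp (-(δ / 2 * s * ((N + 1 : ℕ) : ℝ)))) := by
        have hρm : Measurable fun x : Fin (N + 1) → T3 => ENNReal.ofReal
            ((Literature.Analysis.FluidPDE.canonicalPartition (Literature.Analysis.FluidPDE.Torus.geometry (Fin 3)) (hsDiameter σ N) (N + 1)
              (localGibbsProfile a₀ u₀ θ₀))⁻¹ * posWeight a₀ (hsDiameter σ N) (N + 1) x) :=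
          (measurable_const.mul (measurable_posWeight ha _ _)).ennreal_ofReal
        rw [lintegral_mul_const _ hρm, lintegral_posWeight_eq_one ha hθ hu ha0 hθ0 σ N, one_mul]

end LocalGibbs

end UniformLGC

end Summit.AtomisticToContinuum.HydrodynamicLimit.Theorems

end
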